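import Summits.ResolutionOfSingularities.ResolutionOfSingularities.Theses.WildQuotients
import Summits.ResolutionOfSingularities.ResolutionOfSingularities.Theorems.PAlterationAssembly
import Summits.ResolutionOfSingularities.ResolutionOfSingularities.Theorems.PAlterationPalterationThesisPialtOfPerfect
import Summits.ResolutionOfSingularities.ResolutionOfSingularities.Theorems.PAlterationPialtNormalProjective
import Literature.AlgebraicGeometry.Resolution.ResolutionOfSingularities
import Mathlib.FieldTheory.Fixed
import Mathlib.FieldTheory.IsAlgClosed.Basic
import Mathlib.FieldTheory.RatFunc.Basic
import HarnessLib

/-!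
# Crux `WildQuotients.SummitReduction` (stmt-ResolutionOfSingularities-16324) — ideator 2 sketch

Scratch file of crux-ideate round 1, ideator k = 2. Two idea cards:

* `galois-covers-of-projective-space` (namespace `…GaloisCoversOfProjectiveSpace`): the frame
  `summitReduction_of_wq_imp_pialtPerfectNormalProjective` (PROVED: the crux needs the de Jong
  input only for NORMAL PROJECTIVE varieties over PERFECT fields), the first lemma
  `InvariantsPurelyInseparable` (field theory: invariants of an over-group of the Galois group stay
  purely inseparable over the intermediate field — the hinge letting WQ, applied to ANY subgroup of
  the group acting on the regular top, deliver the purely inseparable alteration of `X = T'/H`),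
  and the typed transfer statement `GaloisCoverRegularAlteration` (de Jong 1997, 5.13/5.15 run on
  Galois covers of a regular base only; the crux-facing, non-log form).
* `rigidity-not-three-points` (namespace `…RigidityNotThreePoints`): `IsA1Rigid`,
  `FermatRigidOverRatFunc` (Mason–Stothers: `u ^ ℓ - w ^ ℓ = 1` has only constant solutions in
  `Ω(t)`; Mathlib `Polynomial.flt`), `FibrewiseIsoIsIso` (flat-closure domination: a proper
  morphism of flat finitely presented `S`-schemes which is an isomorphism on every fibre is an
  isomorphism).

Nothing here is a skeleton; defs are statements to be proved by the line, the one theorem is glue.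
-/

-- single-problem summit: the doubled namespace component `ResolutionOfSingularities` is forced
set_option linter.dupNamespace false

noncomputable section

open CategoryTheory CategoryTheory.Limits AlgebraicGeometry TopologicalSpace

open Literature.AlgebraicGeometry.Resolution

namespace Summit.ResolutionOfSingularities.ResolutionOfSingularities.Cruxes.SummitReduction

/-! ## The crux unfolded at a prime -/

/-- WQ at the prime `p`: the first antecedent of `SummitReduction`, verbatim. -/
def WQAt (p : ℕ) : Prop :=
  ∀ (k : Type) [Field k] [CharP k p] (X' X₁ : Scheme.{0}) (f : X₁ ⟶ Spec (.of k)) (q : X' ⟶ X₁)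
    (G : Type) [Group G] [Finite G] (ρ : G →* Aut X'),
    IsSeparated f → LocallyOfFiniteType f → QuasiCompact f → IsIntegral X₁ → IsIntegral X' →
    Scheme.IsRegular X' → IsFinite q → Function.Surjective q.base →
    (∃ U : X₁.Opens, Dense (U : Set X₁) ∧ Etale (q ∣_ U)) →
    (∀ g : G, (ρ g).hom ≫ q = q) → (∀ x y : X', q.base x = q.base y → ∃ g : G, (ρ g).hom.base x = y) →
      Scheme.HasResolution X₁

/-- PICover at the prime `p`: the second antecedent of `SummitReduction`, verbatim. -/
def PICoverAt (p : ℕ) : Prop :=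
  ∀ (k : Type) [Field k] [CharP k p] (Y X : Scheme.{0}) (f : Y ⟶ Spec (.of k)) (g : X ⟶ Y),
    IsSeparated f → LocallyOfFiniteType f → QuasiCompact f → IsIntegral Y → Scheme.IsRegular Y →
    IsIntegral X → IsFinite g → UniversallyInjective g → Function.Surjective g.base →
      Scheme.HasResolution X

/-- The crux is literally `∀ p prime, WQ_p → PICover_p → ResolutionInChar p`. -/
theorem summitReduction_iff :
    Theses.WildQuotients.SummitReduction ↔
      ∀ p : ℕ, p.Prime → WQAt p → PICoverAt p → ResolutionInChar.{0} p :=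
  Iff.rfl

/-- PIAlt at the prime `p` for NORMAL PROJECTIVE varieties over PERFECT fields only. -/
def PialtPerfectNormalProjectiveAt (p : ℕ) : Prop :=
  ∀ (K : Type) [Field K] [CharP K p] [PerfectField K] (X : Scheme.{0}) (f : X ⟶ Spec (.of K)),
    IsIntegral X → Literature.AlgebraicGeometry.Motives.IsProjectiveOver (Over.mk f) →
      (∀ x : X, IsIntegrallyClosed (X.presheaf.stalk x)) →
        ∃ (X' : Scheme.{0}) (g : X' ⟶ X), IsProper g ∧ IsIntegral X' ∧ Scheme.IsRegular X' ∧
          Function.Surjective g.base ∧ ∃ U : X.Opens, Dense (U : Set X) ∧ IsFinite (g ∣_ U) ∧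
            UniversallyInjective (g ∣_ U)

/-- **Frame (PROVED).** `SummitReduction` follows as soon as, prime by prime, WQ_p yields purely
inseparable regular alterations of NORMAL PROJECTIVE varieties over PERFECT fields of
characteristic `p`: perfect closure + finite-level descent (`stub_pialtOfPerfect`),
Chow + normalisation (`pialtConclusion_of_forall_normal_isProjectiveOver`), Theorem B
(`hasResolution_of_thesis`, every field) and reduced → integral (`DescentReducedToIntegral_holds`),
all in tree. So the de Jong input of this crux is needed exactly for normalisations `T'` of `ℙⁿ_K`
in Galois extensions, `K` perfect. -/
theorem summitReduction_of_wq_imp_pialtPerfectNormalProjective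
    (h : ∀ p : ℕ, p.Prime → WQAt p → PialtPerfectNormalProjectiveAt p) :
    Theses.WildQuotients.SummitReduction := by
  intro p hp hWQ hPC
  haveI : Fact p.Prime := ⟨hp⟩
  have hPN := h p hp hWQ
  have hPI : ∀ (k : Type) [Field k] [CharP k p] (X : Scheme.{0}) (f : X ⟶ Spec (.of k)),
      IsSeparated f → LocallyOfFiniteType f → QuasiCompact f → IsIntegral X →
      ∃ (X' : Scheme.{0}) (g : X' ⟶ X), IsProper g ∧ IsIntegral X' ∧ Scheme.IsRegular X' ∧
        Function.Surjective g.base ∧ ∃ U : X.Opens, Dense (U : Set X) ∧ IsFinite (g ∣_ U) ∧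
        UniversallyInjective (g ∣_ U) := by
    intro k _ _ X f hs hl hq hi
    haveI := hs; haveI := hl; haveI := hq; haveI := hi
    refine Theorems.PalterationThesis.PerfectTransfer.stub_pialtOfPerfect p k (fun Y g h1 h2 h3 h4 => ?_) X f
    haveI := h1; haveI := h2; haveI := h3; haveI := h4
    exact Theorems.pialtConclusion_of_forall_normal_isProjectiveOver g
      (fun X' f' hi' hproj hN => hPN (PerfectClosure k p) X' f' hi' hproj hN)
  intro k _ _ X f hs hl hq hred
  exact Theses.PAlteration.DescentReducedToIntegral_holds k (fun Y g h1 h2 h3 h4 => by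
      haveI := h1; haveI := h2; haveI := h3; haveI := h4
      exact Theorems.hasResolution_of_thesis p hPI hPC g) X f hs hl hq hred

/-! ## Card `galois-covers-of-projective-space` -/

namespace GaloisCoversOfProjectiveSpace

/-- **FIRST LEMMA** (field theory; de Jong 1997, end of proof of Lemma 5.5: "an exercise in Galois
theory that is left to the reader"). A finite group `Γ` acts on a field `E` of characteristic `p`,
`L ⊆ E` is a `Γ`-stable subfield, and the `Γ`-invariants of `E` are purely inseparable over
`L ∩ E^Γ`. Then for every subgroup `H ≤ Γ` containing the pointwise stabiliser of `L`, the
`H`-invariants of `E` are purely inseparable over `L ∩ E^H`. (Proof on paper: `E^H ⊇ L^H · E^Γ`;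
`L^H/L^Γ` is separable of degree `[Γ:H]` (Artin, `H ⊇` stabiliser) and `E^Γ/L^Γ` is purely
inseparable, so they are linearly disjoint and `[L^H E^Γ : E^Γ] = [Γ:H] = [E^H : E^Γ]`, whence
`E^H = L^H E^Γ` is generated over `L^H` by purely inseparable elements.) USE: `E = K(T₁)` (regular
top, `Γ₁` acting), `L = K(T')` (the Galois cover of `ℙⁿ`), `H =` preimage of `Gal(K(T')/K(X))`:
the quotient `T₁/H` is a purely inseparable alteration of `X`, which is what WQ + the frame eat. -/
def InvariantsPurelyInseparable : Prop :=
  ∀ (p : ℕ) [Fact p.Prime] (E : Type) [Field E] [CharP E p] (Γ : Type) [Group Γ] [Finite Γ]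
    [MulSemiringAction Γ E] (L : Subfield E),
    (∀ g : Γ, ∀ x ∈ L, g • x ∈ L) →
    (∀ x : E, (∀ g : Γ, g • x = x) → ∃ n : ℕ, ∃ y ∈ L, x ^ p ^ n = y) →
    ∀ (H : Subgroup Γ), (∀ g : Γ, (∀ y ∈ L, g • y = y) → g ∈ H) →
      ∀ x : E, (∀ h ∈ H, h • x = x) → ∃ n : ℕ, ∃ y ∈ L, (∀ h ∈ H, h • y = y) ∧ x ^ p ^ n = y

/-- **TRANSFER statement `C⁺` in its crux-facing (non-log) form: de Jong's Galois regular
alteration for GALOIS COVERS OF A REGULAR BASE only.** For a regular integral `W` separated of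
finite type over a field `k` and a finite surjective generically étale `π : T ⟶ W` from an integral
`T` carrying an action of a finite group `Γ` over `W` whose orbits are the fibres (so `T` is the
normalisation of `W` in a Galois extension, up to a universal homeomorphism), there are a finite
group `Γ₁ ↠ Γ`, a REGULAR integral `T₁` with a `Γ₁`-action and an equivariant alteration
`α : T₁ ⟶ T`, projective over `W` (closed immersion into some `ℙᴺ_k ×_k W` omitted here: recorded
as quasi-compactness + separatedness + the universally closed `α`; the line states it with
`Motives.IsProjectiveOver` relative to `W`), such that `Γ₁` acts transitively on the geometric
points of `T₁` over the geometric generic point of `W` (⟺ `K(T₁)^{Γ₁}/K(W)` purely inseparable).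
The induction that proves it (card) carries in addition a `Γ`-stable closed `Z ⊊ T` pulled back
into a `Γ₁`-strict normal crossings divisor, and runs with `W = ℙᵐ_k` only. -/
def GaloisCoverRegularAlteration : Prop :=
  ∀ (k : Type) [Field k] (W : Scheme.{0}) (f : W ⟶ Spec (.of k)) [IsIntegral W],
    IsSeparated f → LocallyOfFiniteType f → QuasiCompact f → Scheme.IsRegular W →
    ∀ (T : Scheme.{0}) [IsIntegral T] (π : T ⟶ W) (Γ : Type) [Group Γ] [Finite Γ] (ρ : Γ →* Aut T),
      IsFinite π → Function.Surjective π.base →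
      (∃ U : W.Opens, Dense (U : Set W) ∧ Etale (π ∣_ U)) →
      (∀ g : Γ, (ρ g).hom ≫ π = π) → (∀ x y : T, π.base x = π.base y → ∃ g : Γ, (ρ g).hom.base x = y) →
      ∃ (T₁ : Scheme.{0}) (_ : IsIntegral T₁) (Γ₁ : Type) (_ : Group Γ₁) (_ : Finite Γ₁)
        (ρ₁ : Γ₁ →* Aut T₁) (φ : Γ₁ →* Γ) (α : T₁ ⟶ T),
        Function.Surjective φ ∧ Scheme.IsRegular T₁ ∧ IsProper α ∧ Function.Surjective α.base ∧
        (∃ V : T.Opens, Dense (V : Set T) ∧ IsFinite (α ∣_ V)) ∧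
        (∀ g : Γ₁, (ρ₁ g).hom ≫ α = α ≫ (ρ (φ g)).hom) ∧
        (∀ (Ω : Type) [Field Ω] [IsAlgClosed Ω] (a b : Spec (.of Ω) ⟶ T₁),
            a ≫ α ≫ π = b ≫ α ≫ π →
            (a ≫ α ≫ π).base (IsLocalRing.closedPoint Ω) = genericPoint W →
              ∃ g : Γ₁, a ≫ (ρ₁ g).hom = b)

/-- **Noether normalisation of a projective variety** (support, known: every integral projective
`X` over an INFINITE field admits a finite surjective `k`-morphism onto some `ℙⁿ_k`; over a finite
field after a finite Galois constant extension, which the card absorbs into `Γ`). Typed as the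
existence of a finite surjective morphism to the total space of `Motives.projectiveSpace n k`
compatible with the structure maps. [Mumford, Red Book I §7; de Jong 1996, 2.11] -/
def NoetherProjective : Prop :=
  ∀ (k : Type) [Field k] [Infinite k] (X : Scheme.{0}) (f : X ⟶ Spec (.of k)), IsIntegral X →
    Literature.AlgebraicGeometry.Motives.IsProjectiveOver (Over.mk f) →
      ∃ (n : ℕ) (π : X ⟶ (Literature.AlgebraicGeometry.Motives.projectiveSpace n k).left),
        IsFinite π ∧ Function.Surjective π.base ∧
          π ≫ (Literature.AlgebraicGeometry.Motives.projectiveSpace n k).hom = f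

end GaloisCoversOfProjectiveSpace

/-! ## Card `rigidity-not-three-points` -/

namespace RigidityNotThreePoints

/-- A `k`-scheme `C` is **𝔸¹-rigid** if every `k`-morphism from an affine line over an
algebraically closed field into `C` is constant (genus-free stand-in for "every component of every
geometric fibre has a normalisation of genus `≥ 1`"; for proper `C` it is the same as ℙ¹-rigidity).
This is the property de Jong 1997, (2.1.6)/Lemma 3.13 actually consume. -/
def IsA1Rigid {k : Type} [Field k] {C : Scheme.{0}} (f : C ⟶ Spec (.of k)) : Prop :=
  ∀ (Ω : Type) [Field Ω] [IsAlgClosed Ω] [Algebra k Ω]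
    (g : Spec (.of (Polynomial Ω)) ⟶ C),
    g ≫ f = Spec.map (CommRingCat.ofHom (algebraMap k (Polynomial Ω))) →
      ∃ c : Spec (.of Ω) ⟶ C,
        g = Spec.map (CommRingCat.ofHom (Polynomial.C : Ω →+* Polynomial Ω)) ≫ c

/-- **FIRST LEMMA (a): Fermat rigidity over rational function fields** — for `ℓ ≥ 3` invertible in
`Ω`, `u ^ ℓ - w ^ ℓ = 1` has only constant solutions in `Ω(t)`. With `x = u ^ ℓ` this says that
no non-constant rational function `x(t)` has both `x` and `x - 1` `ℓ`-th powers, i.e. de Jong's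
Kummer curve `C_ℓ → ℙ¹` (`ℓ`-th roots of `x` and `x - 1`, 1997 §3.5) is 𝔸¹-rigid — by
Mason–Stothers (Mathlib `Polynomial.flt`, after clearing denominators), with NO genus theory. -/
def FermatRigidOverRatFunc : Prop :=
  ∀ (Ω : Type) [Field Ω] [IsAlgClosed Ω] (ℓ : ℕ), 3 ≤ ℓ → (ℓ : Ω) ≠ 0 →
    ∀ u w : RatFunc Ω, u ^ ℓ - w ^ ℓ = 1 →
      ∃ a b : Ω, u = algebraMap Ω (RatFunc Ω) a ∧ w = algebraMap Ω (RatFunc Ω) b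

/-- **FIRST LEMMA (b): flat-closure domination.** A proper morphism `f : Γ ⟶ C` of flat, locally
finitely presented `S`-schemes which induces an isomorphism on the fibre over every point of `S`
is an isomorphism (fibrewise criterion of flatness + proper bijective with isomorphic fibres). USE
(card): `Γ` = flattened strict transform of the closure of the generic graph `C_η ⥲ X_η` of the
stable model, iso on fibres by de Jong 1997 Lemma 3.13 along traits; this replaces the closure of
the generic point in `Mor_S(C, X)` (Hom schemes are not in Mathlib). -/
def FibrewiseIsoIsIso : Prop :=
  ∀ (S Γ C : Scheme.{0}) (a : Γ ⟶ S) (b : C ⟶ S) (f : Γ ⟶ C) (hf : f ≫ b = a),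
    Flat a → Flat b → LocallyOfFinitePresentation a → LocallyOfFinitePresentation b →
    IsProper f →
    (∀ s : S, IsIso (pullback.map a (S.fromSpecResidueField s) b (S.fromSpecResidueField s)
        f (𝟙 _) (𝟙 S) (by rw [Category.comp_id, hf]) (by rw [Category.comp_id, Category.id_comp]))) →
      IsIso f

end RigidityNotThreePoints

end Summit.ResolutionOfSingularities.ResolutionOfSingularities.Cruxes.SummitReduction

end
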